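/-
Copyright (c) 2026 the pub-hodgecm-mathlib formalisation cell (harness21).  Prover seat hodgecm-mathlib-LH4-p11 (g8), Track A «(D-RAM) FOUR-FRAME» squad, helper lane on
h413 = stmt-HodgeConjecture-24833 (count-neutral).  Heir dealer∕pen LH4-plan (g13) WORD #70 (2) «(β-BAL) producer»; SCOPE-betaBAL v1 91e23c08 brick B1 (β-BAL-1).  2026-09-04.
-/
import Summits.HodgeConjecture.HodgeConjecture.Theorems.F0P3cDyRamLabelCountDiagonalModel   -- ★ p859223 (LH4-p13 (g8), (L-lab-7)): `latticeValueSetMod_conj_mapGL_eq`, `pairing_diagonal_mulVec_diagonal(_three)`, `diagonal_sub_one_mul_self'`;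
                                                                                            -- brings ★ p858764 `ncard_vertex_fixed_sep_formCongr_eq`, `latticeNearTransvShell_conj_mapGL_iff`, `coe_conj_sub_one`, `diagonal_sub_one`,
                                                                                            -- `diagonal_three_sub_one(_mul_self)`, `diagonal_conj_diagonal`, `latticeInLevel_diagonal_mapGL_iff`, `eq_conj_of_coe_eq_frameElt`; ★ `exists_unimodular_diagonal_frame`,
                                                                                            -- ★ `exists_mem_mapGL_pairing_conj_iff`, ★ `isVertexLattice_smul_iff`
import Summits.HodgeConjecture.HodgeConjecture.Theorems.F0P3cDyRamCleanLabelDefs              -- ★ p859970 DEFS LEAF №7 (LH4-p05 (g8)): `cleanLabelFixCount`, (β-BAL) `CleanLabelKappaBalanceLawAt`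
import Summits.HodgeConjecture.HodgeConjecture.Theorems.F0P3cDyRamSmulXPlusLabel              -- ★ (LH4-p13): `valueSetMod_smul_xPlus` (the reference set of class `e` in the letter `a ↦ e·t₊·N(a)`)
import HarnessLib

/-!
# Crux `H413`, line LH4 «(D-RAM) FOUR-FRAME» — (β-BAL-1) «THE CLASS-`e` CLEAN-SHELL COUNT `cleanLabelFixCount` IN THE UNIMODULAR DIAGONAL MODEL, AND THE FORM-SCALING FLIP»

Cell `hodgecm-mathlib` (D-0151), FLOOR 0, crux item H413 = `stmt-HodgeConjecture-24833`, route `HCCMUnconditional`; squad F0∕P3c∕LH4.  THEOREMS ONLY (no `def`, no instance,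
no notation, no `sorry`, default heartbeats); ★-only imports; lane `--supports stmt-HodgeConjecture-24833 --as helper` (count-neutral); pays NO row, states NO law.

WHY (SCOPE-betaBAL v1 §1∕§2 (iv) B1).  The (β) producer target (β-BAL) `CleanLabelKappaBalanceLawAt N₀ mc` (★ DEFS №7) compares, frame by frame, the κ-censuses of the two
LABEL CLASSES of the clean shell: `cleanLabelFixCount σ ϖ d ℓ m mc e (Γ_b)` at `e = 1` and at `e = u` (a `σ`-fixed non-norm unit).  ★ (L-lab-7) p859223 moved the class-`+`
counts `transvPlus∕MinusFixCount` of a frame literal `Γ_b(α, β) = A·diag(α, β, 1)·A⁻¹` into the unimodular diagonal model `(K³, diag(c))`, `ᵗσ(A)Φ₃A = diag(c)`,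
`ω(c_i) = ω(N(f b i))`; this file does the same for the class-`e` count on the `(ℓ, m, mc)` CLEAN shell (§1–§3: the same three steps, the label now read against
`valueSetMod σ ϖ m (e • X₊)` and the square token at the clean level `mc`), for ALL classes `e` with ONE model `(A, c)` per frame (§5 HEAD), records the class-only dependence
of the model count (§3, ★ p859223 §4 pattern), and adds the FORM-SCALING FLIP (§4): scaling the model form by a unit `u` keeps the vertex set, `T`-fixedness and both shell
tokens and multiplies every value `⟨y, X y⟩` by `u`, so the class-`e` count for `diag(u·c)` is the class-`u⁻¹·e` count for `diag(c)` — the dictionary between the four frames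
and the four label-flipped «non-frame» sign patterns of the eightfold model sum (SCOPE (R2): `N^±(ē) = N^∓(e)`).
* §1 `cleanLabelFixCount_conj_eq` (any model `ᵗσ(A)Φ₃A = H′`, any `T`, `Γ = A·T·A⁻¹`).
* §2 `cleanLabelFixCount_conj_diagonal` (`T = diag(s)`, `H′ = diag(c)`: shell tokens `diag(s−1)` at `ℓ, ℓ+1`, `diag((s−1)²)` at `mc`, label = the norm form `Σ c_i(s_i−1)N(y_i)` at `m`).
* §3 `ncard_cleanLabel_diagonal_eq_of_exists_norm` (class-only dependence on `c`).
* §4 `mem_valueSetMod_smul_xPlus_iff_mul_mem`, `setOf_value_smul_eq_iff`, `ncard_cleanLabel_diagonal_smul_form` (the flip `(u·c, e) ↔ (c, u⁻¹·e)`).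
* §5 HEAD `exists_diagonal_model_cleanLabelFixCount` — for a four-frame family and a frame `b`: ∃ unit `σ`-fixed `c` with `ω(c_i) = ω(N(f b i))` such that for ALL `α β T Γ d ℓ m mc e`
  the ★ №7 count is the model count with the BINARY norm-form label `{c₀(α−1)N(y₀) + c₁(β−1)N(y₁)}~ = valueSetMod σ ϖ m (e • X₊)`.
HONEST LABEL.  Count-neutral change of model; (β-BAL), (A″), (β) and the tier-0 T₊ row stay OPEN; `HC_CM` is proved only modulo the 7 printed citations (2 remaining named
inputs: hLiu418 = `stmt-HodgeConjecture-24832`, h413 = `stmt-HodgeConjecture-24833`) until rung 0 closes.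

## References
* [Kottwitz1986BaseChangeUnits] R. E. Kottwitz, *Base change for unit elements of Hecke algebras*, Compositio Math. 60 (1986), §1 pp. 240–241 (κ-orbital integrals as signed
  lattice counts in a diagonal torus model).
* [Rogawski1990] J. D. Rogawski, *Automorphic Representations of Unitary Groups in Three Variables*, Ann. of Math. Stud. 123 (1990), §4.9 Prop. 4.9.1 (a)(b) p. 55.
* [Jacobowitz1962] R. Jacobowitz, *Hermitian forms over local fields*, Amer. J. Math. 84 (1962), §4 (Gram matrices, scaling, norm classes of diagonal forms).
* [BruhatTits1972] F. Bruhat, J. Tits, *Groupes réductifs sur un corps local I*, Publ. Math. IHÉS 41 (1972), §10 (lattice models; change of frame).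
* [LanglandsShelstad1987] R. P. Langlands, D. Shelstad, *On the definition of transfer factors*, Math. Ann. 278 (1987), §3.
-/

set_option autoImplicit false

noncomputable section

namespace Summit.HodgeConjecture.HodgeConjecture.Cruxes.H413.F0P3cDyRamCleanLabelCountDiagonalModel

open Literature.NumberTheory.Automorphic Literature.NumberTheory.Automorphic.HermitianLattice Literature.NumberTheory.Automorphic.UnitaryGroup
open Literature.NumberTheory.Automorphic.UnitaryLatticeTree Literature.NumberTheory.Automorphic.UnitaryThreeFourFrame
open Summit.HodgeConjecture.HodgeConjecture.Cruxes.H413.F0P3cDyRamFourFramePieces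
open Summit.HodgeConjecture.HodgeConjecture.Cruxes.H413.F0P3cDyRamFourFrameCensusDefs
open Summit.HodgeConjecture.HodgeConjecture.Cruxes.H413.F0P3cDyRamFixedCountDiagonalModel (exists_unimodular_diagonal_frame)
open Summit.HodgeConjecture.HodgeConjecture.Cruxes.H413.F0P3cDyRamLevelCountDiagonalModel
open Summit.HodgeConjecture.HodgeConjecture.Cruxes.H413.F0P3cDyRamLabelCountDiagonalModel
open Summit.HodgeConjecture.HodgeConjecture.Cruxes.H413.F0P3cDyRamCleanLabelDefs
open Summit.HodgeConjecture.HodgeConjecture.Cruxes.H413.F0P3cDyRamSmulXPlusLabel (valueSetMod_smul_xPlus)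
open scoped Valued WithZero Matrix MatrixGroups

/-! ## §1  The class-`e` clean-shell count of a conjugate `Γ = A·T·A⁻¹` in the model `H′ = ᵗσ(A)Φ₃A` -/

section Transport

variable {K : Type} [Field K] [Valued K ℤᵐ⁰]

/-- **`cleanLabelFixCount` OF A CONJUGATE** (any model `ᵗσ(A)·Φ₃·A = H′`, any `T`): for `Γ = A·T·A⁻¹`,
`cleanLabelFixCount σ ϖ d ℓ m mc e Γ = #{M : type 0 for H′, T·M = M, LatticeNearTransvShell ϖ ℓ mc (T−1) M, ‹H′-value set of T−1 on M at ϖ^m› = valueSetMod σ ϖ m (e • X₊)}`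
— the shell tokens by ★ `latticeNearTransvShell_conj_mapGL_iff`, the value token by ★ `latticeValueSetMod_conj_mapGL_eq`.
[cite: Kottwitz1986BaseChangeUnits, §1 pp. 240–241] [cite: Rogawski1990, §4.9 Prop. 4.9.1 (b) p. 55] [cite: BruhatTits1972, §10] -/
theorem cleanLabelFixCount_conj_eq (σ : K →+* K) (ϖ : K) {H' : Matrix (Fin 3) (Fin 3) K} {A T Γ : GL (Fin 3) K}
    (hA : formCongr σ A ((StdForm.antidiagonal 3).over K) = H') (hΓ : Γ = A * T * A⁻¹) (d ℓ m mc : ℕ) (e : K) :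
    cleanLabelFixCount σ ϖ d ℓ m mc e Γ =
      {M : Submodule 𝒪[K] (Fin 3 → K) | IsVertexLattice σ ϖ H' 0 M ∧ mapGL T M = M ∧
        (LatticeNearTransvShell ϖ ℓ mc ((T : Matrix (Fin 3) (Fin 3) K) - 1) M ∧
          {v | ∃ y ∈ M, Valued.v ((ϖ ^ m)⁻¹ * (v - pairing σ H' y (((T : Matrix (Fin 3) (Fin 3) K) - 1) *ᵥ y))) ≤ 1} =
            valueSetMod σ ϖ m (e • xPlus σ ϖ d))}.ncard := by
  subst hΓ
  unfold cleanLabelFixCount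
  rw [← hA]
  refine (ncard_vertex_fixed_sep_formCongr_eq σ ϖ ((StdForm.antidiagonal 3).over K) A T 0 _ _ fun M => ?_).symm
  rw [F0P3cDyRamLevelCountDiagonalModel.coe_conj_sub_one, latticeNearTransvShell_conj_mapGL_iff, latticeValueSetMod_conj_mapGL_eq]

/-! ## §2  Diagonal `T`, diagonal model -/

/-- **`cleanLabelFixCount` OF A CONJUGATE OF A DIAGONAL MATRIX** (`T = diag(s)`, model `H′ = diag(c)`): shell tokens `diag(s − 1)` at levels `ℓ`, `ℓ + 1` and `diag((s−1)²)` at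
the clean level `mc`; label «`{Σ_i σ(y_i)·c_i·((s_i − 1)·y_i) | y ∈ M} + ϖ^m𝒪 = valueSetMod σ ϖ m (e • X₊)`». [cite: Kottwitz1986BaseChangeUnits, §1 pp. 240–241] [cite: Jacobowitz1962, §4] -/
theorem cleanLabelFixCount_conj_diagonal (σ : K →+* K) (ϖ : K) {c : Fin 3 → K} {A T Γ : GL (Fin 3) K}
    (hA : formCongr σ A ((StdForm.antidiagonal 3).over K) = Matrix.diagonal c) (hΓ : Γ = A * T * A⁻¹) {s : Fin 3 → K}
    (hT : (T : Matrix (Fin 3) (Fin 3) K) = Matrix.diagonal s) (d ℓ m mc : ℕ) (e : K) :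
    cleanLabelFixCount σ ϖ d ℓ m mc e Γ =
      {M : Submodule 𝒪[K] (Fin 3 → K) | IsVertexLattice σ ϖ (Matrix.diagonal c) 0 M ∧ mapGL T M = M ∧
        ((LatticeInLevel ϖ ℓ (Matrix.diagonal fun i => s i - 1) M ∧ ¬ LatticeInLevel ϖ (ℓ + 1) (Matrix.diagonal fun i => s i - 1) M ∧
            LatticeInLevel ϖ mc (Matrix.diagonal fun i => (s i - 1) * (s i - 1)) M) ∧
          {v | ∃ y ∈ M, Valued.v ((ϖ ^ m)⁻¹ * (v - ∑ i, σ (y i) * c i * ((s i - 1) * y i))) ≤ 1} = valueSetMod σ ϖ m (e • xPlus σ ϖ d))}.ncard := by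
  rw [cleanLabelFixCount_conj_eq σ ϖ hA hΓ, hT, diagonal_sub_one]
  unfold LatticeNearTransvShell
  rw [diagonal_sub_one_mul_self']
  simp only [pairing_diagonal_mulVec_diagonal]

/-! ## §3  Class-only dependence of the class-`e` model count -/

/-- **CLASS-ONLY DEPENDENCE.**  Two unit diagonal models `diag(c)`, `diag(c′)` with `σ(z_i)·c_i·z_i = c′_i` (`z_i ≠ 0`) have the same class-`e` clean-shell counts for every
diagonal `T = diag(s)` and all `(ℓ, m, mc)`: `diag(z)` is a congruence commuting with `T` and with the diagonal level operators (★ `latticeInLevel_diagonal_mapGL_iff`), and the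
value token follows it (★ `exists_mem_mapGL_pairing_conj_iff`); `F` reads the label equation (`id`) or its negation (`Not`).  So the model counts of a frame depend on `c`
only through `(ω(c₀), ω(c₁), ω(c₂))`. [cite: Jacobowitz1962, §4] [cite: BruhatTits1972, §10] [cite: LanglandsShelstad1987, §3] -/
theorem ncard_cleanLabel_diagonal_eq_of_exists_norm (σ : K →+* K) (ϖ : K) {c c' : Fin 3 → K} (h : ∀ i, ∃ z : K, z ≠ 0 ∧ σ z * c i * z = c' i)
    (s : Fin 3 → K) (T : GL (Fin 3) K) (hT : (T : Matrix (Fin 3) (Fin 3) K) = Matrix.diagonal s) (d ℓ m mc : ℕ) (e : K) (F : Prop → Prop) :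
    {M : Submodule 𝒪[K] (Fin 3 → K) | IsVertexLattice σ ϖ (Matrix.diagonal c') 0 M ∧ mapGL T M = M ∧
        ((LatticeInLevel ϖ ℓ (Matrix.diagonal fun i => s i - 1) M ∧ ¬ LatticeInLevel ϖ (ℓ + 1) (Matrix.diagonal fun i => s i - 1) M ∧
            LatticeInLevel ϖ mc (Matrix.diagonal fun i => (s i - 1) * (s i - 1)) M) ∧
          F ({v | ∃ y ∈ M, Valued.v ((ϖ ^ m)⁻¹ * (v - ∑ i, σ (y i) * c' i * ((s i - 1) * y i))) ≤ 1} = valueSetMod σ ϖ m (e • xPlus σ ϖ d)))}.ncard =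
      {M : Submodule 𝒪[K] (Fin 3 → K) | IsVertexLattice σ ϖ (Matrix.diagonal c) 0 M ∧ mapGL T M = M ∧
        ((LatticeInLevel ϖ ℓ (Matrix.diagonal fun i => s i - 1) M ∧ ¬ LatticeInLevel ϖ (ℓ + 1) (Matrix.diagonal fun i => s i - 1) M ∧
            LatticeInLevel ϖ mc (Matrix.diagonal fun i => (s i - 1) * (s i - 1)) M) ∧
          F ({v | ∃ y ∈ M, Valued.v ((ϖ ^ m)⁻¹ * (v - ∑ i, σ (y i) * c i * ((s i - 1) * y i))) ≤ 1} = valueSetMod σ ϖ m (e • xPlus σ ϖ d)))}.ncard := by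
  classical
  choose z hz0 hz using h
  let P : GL (Fin 3) K :=
    ⟨Matrix.diagonal z, Matrix.diagonal fun i => (z i)⁻¹,
      by rw [Matrix.diagonal_mul_diagonal, ← Matrix.diagonal_one]; congr 1; funext i; exact mul_inv_cancel₀ (hz0 i),
      by rw [Matrix.diagonal_mul_diagonal, ← Matrix.diagonal_one]; congr 1; funext i; exact inv_mul_cancel₀ (hz0 i)⟩
  have hP : (P : Matrix (Fin 3) (Fin 3) K) = Matrix.diagonal z := rfl
  have hform : formCongr σ P (Matrix.diagonal c) = Matrix.diagonal c' := by
    rw [formCongr, hP, Matrix.diagonal_map (map_zero σ), Matrix.diagonal_transpose, Matrix.diagonal_mul_diagonal, Matrix.diagonal_mul_diagonal]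
    congr 1; funext i; exact hz i
  have hcomm : P * T * P⁻¹ = T := Units.ext (by rw [Units.val_mul, Units.val_mul, hT, diagonal_conj_diagonal hP])
  have hlab : ∀ M : Submodule 𝒪[K] (Fin 3 → K),
      {v | ∃ y ∈ mapGL P M, Valued.v ((ϖ ^ m)⁻¹ * (v - ∑ i, σ (y i) * c i * ((s i - 1) * y i))) ≤ 1} =
        {v | ∃ y ∈ M, Valued.v ((ϖ ^ m)⁻¹ * (v - ∑ i, σ (y i) * c' i * ((s i - 1) * y i))) ≤ 1} := by
    intro M
    ext v
    simp only [Set.mem_setOf_eq]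
    have key := exists_mem_mapGL_pairing_conj_iff σ (Matrix.diagonal c) P (Matrix.diagonal fun i => s i - 1) M
      (fun w => Valued.v ((ϖ ^ m)⁻¹ * (v - w)) ≤ 1)
    rw [diagonal_conj_diagonal hP, hform] at key
    simpa only [pairing_diagonal_mulVec_diagonal] using key
  have key := ncard_vertex_fixed_sep_formCongr_eq σ ϖ (Matrix.diagonal c) P T 0
    (fun M => (LatticeInLevel ϖ ℓ (Matrix.diagonal fun i => s i - 1) M ∧ ¬ LatticeInLevel ϖ (ℓ + 1) (Matrix.diagonal fun i => s i - 1) M ∧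
        LatticeInLevel ϖ mc (Matrix.diagonal fun i => (s i - 1) * (s i - 1)) M) ∧
      F ({v | ∃ y ∈ M, Valued.v ((ϖ ^ m)⁻¹ * (v - ∑ i, σ (y i) * c i * ((s i - 1) * y i))) ≤ 1} = valueSetMod σ ϖ m (e • xPlus σ ϖ d)))
    (fun M => (LatticeInLevel ϖ ℓ (Matrix.diagonal fun i => s i - 1) M ∧ ¬ LatticeInLevel ϖ (ℓ + 1) (Matrix.diagonal fun i => s i - 1) M ∧
        LatticeInLevel ϖ mc (Matrix.diagonal fun i => (s i - 1) * (s i - 1)) M) ∧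
      F ({v | ∃ y ∈ M, Valued.v ((ϖ ^ m)⁻¹ * (v - ∑ i, σ (y i) * c' i * ((s i - 1) * y i))) ≤ 1} = valueSetMod σ ϖ m (e • xPlus σ ϖ d)))
    (fun M => by rw [latticeInLevel_diagonal_mapGL_iff hP, latticeInLevel_diagonal_mapGL_iff hP, latticeInLevel_diagonal_mapGL_iff hP, hlab M])
  rw [← hform, key, hcomm]

/-! ## §4  The form-scaling flip: `(diag(u·c), class e) ↔ (diag(c), class u⁻¹·e)` -/

/-- Membership in the reference set of class `e` under division by a unit: for `|u| = 1`, `z ∈ valueSetMod σ ϖ m (e • X₊) ↔ u⁻¹·z ∈ valueSetMod σ ϖ m ((u⁻¹·e) • X₊)`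
(★ `valueSetMod_smul_xPlus`: both sets are `{e′·t₊·N(a)}~` with `e′ = e`, `u⁻¹e`; `|(ϖ^m)⁻¹·x| = |(ϖ^m)⁻¹·u⁻¹x|`). [cite: Serre1979, Ch. V §3 Cor. 3] [cite: Jacobowitz1962, §4] -/
theorem mem_valueSetMod_smul_xPlus_iff_mul_mem (σ : K →+* K) (ϖ : K) (d m : ℕ) (e : K) {u : K} (hu : Valued.v u = 1) (z : K) :
    z ∈ valueSetMod σ ϖ m (e • xPlus σ ϖ d) ↔ u⁻¹ * z ∈ valueSetMod σ ϖ m ((u⁻¹ * e) • xPlus σ ϖ d) := by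
  have hvu : ∀ x : K, Valued.v ((ϖ ^ m)⁻¹ * (u⁻¹ * x)) = Valued.v ((ϖ ^ m)⁻¹ * x) := fun x => by
    rw [map_mul, map_mul, map_mul, map_inv₀ _ u, hu, inv_one, one_mul]
  rw [valueSetMod_smul_xPlus, valueSetMod_smul_xPlus]
  simp only [Set.mem_setOf_eq]
  refine exists_congr fun a => and_congr_right fun _ => ?_
  rw [show u⁻¹ * z - u⁻¹ * e * ((ϖ - σ ϖ) * ((ϖ * σ ϖ) ^ ((d - d % 2) / 2))⁻¹ * (a * σ a)) =
      u⁻¹ * (z - e * ((ϖ - σ ϖ) * ((ϖ * σ ϖ) ^ ((d - d % 2) / 2))⁻¹ * (a * σ a))) by ring, hvu]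

/-- **THE LABEL EQUATION UNDER A UNIT RESCALING OF THE VALUES.**  For a unit `u` and any value functional `w` on a set `M`:
`{v | ∃ y ∈ M, |(ϖ^m)⁻¹(v − u·w y)| ≤ 1} = valueSetMod σ ϖ m (e • X₊) ↔ {v | ∃ y ∈ M, |(ϖ^m)⁻¹(v − w y)| ≤ 1} = valueSetMod σ ϖ m ((u⁻¹·e) • X₊)` — both sides are the
`u`-multiples of the unscaled sets. [cite: Serre1979, Ch. V §3 Cor. 3] [cite: Jacobowitz1962, §4] -/
theorem setOf_value_smul_eq_iff (σ : K →+* K) (ϖ : K) (d m : ℕ) (e : K) {u : K} (hu : Valued.v u = 1) (M : Submodule 𝒪[K] (Fin 3 → K)) (w : (Fin 3 → K) → K) :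
    {v | ∃ y ∈ M, Valued.v ((ϖ ^ m)⁻¹ * (v - u * w y)) ≤ 1} = valueSetMod σ ϖ m (e • xPlus σ ϖ d) ↔
      {v | ∃ y ∈ M, Valued.v ((ϖ ^ m)⁻¹ * (v - w y)) ≤ 1} = valueSetMod σ ϖ m ((u⁻¹ * e) • xPlus σ ϖ d) := by
  have hu0 : u ≠ 0 := fun h => by rw [h, map_zero] at hu; exact zero_ne_one hu
  have hvu : ∀ x : K, Valued.v ((ϖ ^ m)⁻¹ * (u⁻¹ * x)) = Valued.v ((ϖ ^ m)⁻¹ * x) := fun x => by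
    rw [map_mul, map_mul, map_mul, map_inv₀ _ u, hu, inv_one, one_mul]
  -- membership in the scaled value set = membership of `u⁻¹·v` in the unscaled one
  have hmem : ∀ v : K, v ∈ {v | ∃ y ∈ M, Valued.v ((ϖ ^ m)⁻¹ * (v - u * w y)) ≤ 1} ↔
      u⁻¹ * v ∈ {v | ∃ y ∈ M, Valued.v ((ϖ ^ m)⁻¹ * (v - w y)) ≤ 1} := by
    intro v
    simp only [Set.mem_setOf_eq]
    refine exists_congr fun y => and_congr_right fun _ => ?_
    rw [show u⁻¹ * v - w y = u⁻¹ * (v - u * w y) by field_simp, hvu]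
  constructor
  · intro h
    ext v
    have h1 := Set.ext_iff.1 h (u * v)
    rw [hmem, mem_valueSetMod_smul_xPlus_iff_mul_mem σ ϖ d m e hu, inv_mul_cancel_left₀ hu0] at h1
    exact h1
  · intro h
    ext v
    rw [hmem, mem_valueSetMod_smul_xPlus_iff_mul_mem σ ϖ d m e hu, h]

/-- **THE FORM-SCALING FLIP.**  For a unit `u` (`|u| = 1`), a unit diagonal model `diag(c)`, a diagonal `T = diag(s)` and all `(ℓ, m, mc, e)`: the class-`e` clean-shell count
of `T` in the model `diag(u • c)` equals the class-`u⁻¹·e` count in the model `diag(c)` — the type-0 vertices agree (★ `isVertexLattice_smul_iff`), `T`-fixedness and the three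
level tokens do not read the form, and the values `Σ σ(y_i)(u c_i)((s_i−1)y_i) = u·Σ σ(y_i)c_i((s_i−1)y_i)` are the `u`-multiples (§4 `setOf_value_smul_eq_iff`).  With `u` a
`σ`-fixed NON-norm unit this is the dictionary «sign pattern `ē` with label `+` = sign pattern `e` with label `−′`» of the eightfold model sum (SCOPE-betaBAL v1 (R2)).
[cite: Kottwitz1986BaseChangeUnits, §1 pp. 240–241] [cite: Jacobowitz1962, §4] [cite: LanglandsShelstad1987, §3] -/
theorem ncard_cleanLabel_diagonal_smul_form (σ : K →+* K) (ϖ : K) {u : K} (hu : Valued.v u = 1) (c s : Fin 3 → K) (T : GL (Fin 3) K) (d ℓ m mc : ℕ) (e : K) :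
    {M : Submodule 𝒪[K] (Fin 3 → K) | IsVertexLattice σ ϖ (Matrix.diagonal (u • c)) 0 M ∧ mapGL T M = M ∧
        ((LatticeInLevel ϖ ℓ (Matrix.diagonal fun i => s i - 1) M ∧ ¬ LatticeInLevel ϖ (ℓ + 1) (Matrix.diagonal fun i => s i - 1) M ∧
            LatticeInLevel ϖ mc (Matrix.diagonal fun i => (s i - 1) * (s i - 1)) M) ∧
          {v | ∃ y ∈ M, Valued.v ((ϖ ^ m)⁻¹ * (v - ∑ i, σ (y i) * (u • c) i * ((s i - 1) * y i))) ≤ 1} = valueSetMod σ ϖ m (e • xPlus σ ϖ d))}.ncard =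
      {M : Submodule 𝒪[K] (Fin 3 → K) | IsVertexLattice σ ϖ (Matrix.diagonal c) 0 M ∧ mapGL T M = M ∧
        ((LatticeInLevel ϖ ℓ (Matrix.diagonal fun i => s i - 1) M ∧ ¬ LatticeInLevel ϖ (ℓ + 1) (Matrix.diagonal fun i => s i - 1) M ∧
            LatticeInLevel ϖ mc (Matrix.diagonal fun i => (s i - 1) * (s i - 1)) M) ∧
          {v | ∃ y ∈ M, Valued.v ((ϖ ^ m)⁻¹ * (v - ∑ i, σ (y i) * c i * ((s i - 1) * y i))) ≤ 1} = valueSetMod σ ϖ m ((u⁻¹ * e) • xPlus σ ϖ d))}.ncard := by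
  have hsum : ∀ y : Fin 3 → K, (∑ i, σ (y i) * (u • c) i * ((s i - 1) * y i)) = u * ∑ i, σ (y i) * c i * ((s i - 1) * y i) := by
    intro y
    rw [Finset.mul_sum]
    exact Finset.sum_congr rfl fun i _ => by rw [Pi.smul_apply, smul_eq_mul]; ring
  congr 1
  ext M
  simp only [Set.mem_setOf_eq, Matrix.diagonal_smul, isVertexLattice_smul_iff (σ := σ) (ϖ := ϖ) hu, hsum,
    setOf_value_smul_eq_iff σ ϖ d m e hu M]

end Transport

/-! ## §5  The four-frame head: `cleanLabelFixCount` of `Γ_b(α, β)` in the unimodular diagonal model, all classes at once -/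

section Frame

variable {K : Type} [Field K] [Valued K ℤᵐ⁰] {σ : K →+* K} {ϖ : K}

/-- **HEAD — THE CLASS-`e` CLEAN-SHELL CENSUS OF A FRAME ELEMENT IN THE UNIMODULAR DIAGONAL MODEL.**  Under the datum clauses (`σ` an involutive isometry whose fixed
elements have even valuation, `|ϖ| = exp(−1)`), for a four-frame family `f` and a frame `b` there is a unit diagonal form `diag(c)` — `|c_i| = 1`, `σ c_i = c_i`,
`ω(c_i) = ω(N(f b i))` (so `(ω(c₀), ω(c₁)) = signPair b`) — such that for ALL `α, β`, every `T ∈ GL₃` with matrix `diag(α, β, 1)`, every `Γ ∈ GL₃` with matrix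
`Γ_b(α, β) = frameElt σ f b α β`, all `d, ℓ, m, mc` and EVERY class scalar `e`:  `cleanLabelFixCount σ ϖ d ℓ m mc e Γ` is the number of type-0 vertices `M` of `(K³, diag(c))`
with `T·M = M`, `diag(α−1, β−1, 0)·M ⊆ ϖ^ℓM`, `⊄ ϖ^{ℓ+1}M`, `diag((α−1)², (β−1)², 0)·M ⊆ ϖ^{mc}M`, and the BINARY NORM-FORM CLASS
`{c₀(α−1)·N(y₀) + c₁(β−1)·N(y₁) | y ∈ M} + ϖ^m𝒪 = valueSetMod σ ϖ m (e • X₊)`.  ONE model `(A, c)` serves both label classes of (β-BAL) at once.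
[cite: Rogawski1990, §4.9 Prop. 4.9.1 (a)(b) p. 55] [cite: Kottwitz1986BaseChangeUnits, §1 pp. 240–241] [cite: BruhatTits1972, §10] [cite: LanglandsShelstad1987, §3] -/
theorem exists_diagonal_model_cleanLabelFixCount (hσ : ∀ x, σ (σ x) = x) (hvσ : ∀ a, Valued.v (σ a) = Valued.v a)
    (hϖ : Valued.v ϖ = WithZero.exp (-1 : ℤ)) (heven : ∀ x : K, σ x = x → x ≠ 0 → ∃ n : ℤ, Valued.v x = WithZero.exp (2 * n))
    {f : Fin 4 → Fin 3 → (Fin 3 → K)} (hf : IsFourFrameFamily σ f) (b : Fin 4) :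
    ∃ c : Fin 3 → K, (∀ i, Valued.v (c i) = 1) ∧ (∀ i, σ (c i) = c i) ∧
      (∀ i, normSign σ (c i) = normSign σ (pairing σ ((StdForm.antidiagonal 3).over K) (f b i) (f b i))) ∧
      ∀ (α β : K) (T Γ : GL (Fin 3) K), (T : Matrix (Fin 3) (Fin 3) K) = Matrix.diagonal ![α, β, 1] →
        (Γ : Matrix (Fin 3) (Fin 3) K) = frameElt σ f b α β → ∀ (d ℓ m mc : ℕ) (e : K),
        cleanLabelFixCount σ ϖ d ℓ m mc e Γ =
            {M : Submodule 𝒪[K] (Fin 3 → K) | IsVertexLattice σ ϖ (Matrix.diagonal c) 0 M ∧ mapGL T M = M ∧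
              ((LatticeInLevel ϖ ℓ (Matrix.diagonal ![α - 1, β - 1, 0]) M ∧ ¬ LatticeInLevel ϖ (ℓ + 1) (Matrix.diagonal ![α - 1, β - 1, 0]) M ∧
                  LatticeInLevel ϖ mc (Matrix.diagonal ![(α - 1) * (α - 1), (β - 1) * (β - 1), 0]) M) ∧
                {v | ∃ y ∈ M, Valued.v ((ϖ ^ m)⁻¹ * (v - (c 0 * (α - 1) * (y 0 * σ (y 0)) + c 1 * (β - 1) * (y 1 * σ (y 1))))) ≤ 1} =
                  valueSetMod σ ϖ m (e • xPlus σ ϖ d))}.ncard := by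
  obtain ⟨A, c, hc, hσc, hcls, hA, hconj⟩ := exists_unimodular_diagonal_frame hσ hvσ hϖ heven hf b
  refine ⟨c, hc, hσc, hcls, fun α β T Γ hT hΓ d ℓ m mc e => ?_⟩
  have hΓ' : Γ = A * T * A⁻¹ := eq_conj_of_coe_eq_frameElt hconj hT hΓ
  have hD₁ : Matrix.diagonal ![α, β, (1 : K)] - 1 = Matrix.diagonal ![α - 1, β - 1, 0] := by rw [diagonal_three_sub_one, sub_self]
  have hD₂ : (Matrix.diagonal ![α, β, (1 : K)] - 1) * (Matrix.diagonal ![α, β, 1] - 1) = Matrix.diagonal ![(α - 1) * (α - 1), (β - 1) * (β - 1), 0] := by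
    rw [diagonal_three_sub_one_mul_self, sub_self, mul_zero]
  rw [cleanLabelFixCount_conj_eq σ ϖ hA hΓ', hT]
  unfold LatticeNearTransvShell
  rw [hD₂, hD₁]
  simp only [pairing_diagonal_mulVec_diagonal_three]

end Frame

end Summit.HodgeConjecture.HodgeConjecture.Cruxes.H413.F0P3cDyRamCleanLabelCountDiagonalModel

end
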